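import Mathlib

/-!
# Exponent bookkeeping for the capacity-gadget transfer, uniform in the word length (support file)

Item `stmt-MatrixMultiplication-14308` (`FourierTwoFamiliesModP.PrimeTwoFamilies`, CKSU 2005 Conj. 4.7 with
prime cyclic hosts), line `Sketch` (cycle c1, capacity-gadget skeleton `Cruxes/PrimeTwoFamilies/Lines/Sketch.lean`),
registered stub `stub_capBookkeeping`.

Pure real-exponent bookkeeping.  In the skeleton a zero-error code of `N ≥ (m ^ L) ^ (1/2 - ε)` words
over letters of co-volume `≥ m ^ (1 - ε)` in `ℤ/m` is lifted to `N` blocks in `(ℤ/m) ^ L` of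
co-volume `≥ (m ^ (1 - ε)) ^ L` and transferred into a prime `p ≤ 2·3^L·m^L`; this file chooses how
many blocks `n` to keep: `n₀ ≤ n ≤ N`, `p ≤ n ^ (2 + δ)` and `n ^ (2 - δ) ≤ (m ^ (1 - ε)) ^ L`,
with a threshold `m₀` on `m` that is uniform in the word length `L ≥ 1`.

Choices: `ε := δ / 8`, `n := max n₀ ⌈A⌉₊` with `A := (2·3^L·m^L) ^ (1/(2+δ))`, and `m₀` so large
that `6 (n₀ + 2) ^ (2 + δ) ≤ m ^ (δ / 8)` for `m ≥ m₀` (lemma `eventually_dominates`).  Then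
`n ≤ B := (n₀ + 2) A` and
`B ^ (2 + δ) = (n₀ + 2) ^ (2 + δ) · 2·3^L·m^L ≤ (6 (n₀ + 2) ^ (2 + δ)) ^ L · m ^ L ≤ m ^ (δ L / 8 + L)`,
so `B ≤ m ^ θ` with `θ := (δ L / 8 + L) / (2 + δ)`.  The two elementary exponent comparisons
`θ ≤ L (1/2 - δ/8)` (uses `δ ≤ 1`) and `θ (2 - δ) ≤ (1 - δ/8) L` (lemma `exponent_gaps`) give
`n ≤ B ≤ (m ^ L) ^ (1/2 - ε) ≤ N` and `n ^ (2 - δ) ≤ B ^ (2 - δ) ≤ (m ^ (1 - ε)) ^ L`, while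
`p ≤ 2·3^L·m^L = A ^ (2 + δ) ≤ n ^ (2 + δ)` holds by the choice of `n`.
-/

-- single-conjunct summit: the mandated namespace repeats `MatrixMultiplication` (summit = sub-problem).
set_option linter.dupNamespace false

namespace Summit.MatrixMultiplication.MatrixMultiplication.Theorems.PrimeTwoFamilies.CapacityLift

-- adapted from Summits/MatrixMultiplication/MatrixMultiplication/Theorems/
--   FourierTwoFamiliesModPPrimeTwoFamiliesStubBookkeeping.lean (`LadderLift.eventually_dominates`)
/-- A constant multiple of a smaller real power of `m` is eventually dominated by a larger power:
if `0 < K` and `a < b` then `K * m ^ a ≤ m ^ b` for all naturals `m ≥ ⌈K ^ (1/(b-a))⌉₊ + 1`. -/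
private theorem eventually_dominates (K a b : ℝ) (hK : 0 < K) (hab : a < b) :
    ∃ m₀ : ℕ, ∀ m : ℕ, m₀ ≤ m → K * (m : ℝ) ^ a ≤ (m : ℝ) ^ b := by
  have hc : 0 < b - a := sub_pos.mpr hab
  refine ⟨⌈K ^ (b - a)⁻¹⌉₊ + 1, fun m hm => ?_⟩
  have hm1 : ((⌈K ^ (b - a)⁻¹⌉₊ + 1 : ℕ) : ℝ) ≤ m := by exact_mod_cast hm
  push_cast at hm1
  have hceil : K ^ (b - a)⁻¹ ≤ (⌈K ^ (b - a)⁻¹⌉₊ : ℝ) := Nat.le_ceil _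
  have hT0 : (0 : ℝ) ≤ K ^ (b - a)⁻¹ := Real.rpow_nonneg hK.le _
  have hKm' : K ^ (b - a)⁻¹ ≤ (m : ℝ) := by linarith
  have hm0 : (0 : ℝ) < m := by linarith
  have hKm : K ≤ (m : ℝ) ^ (b - a) := by
    calc K = (K ^ (b - a)⁻¹) ^ (b - a) := (Real.rpow_inv_rpow hK.le hc.ne').symm
      _ ≤ (m : ℝ) ^ (b - a) := Real.rpow_le_rpow hT0 hKm' hc.le
  calc K * (m : ℝ) ^ a ≤ (m : ℝ) ^ (b - a) * (m : ℝ) ^ a :=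
        mul_le_mul_of_nonneg_right hKm (Real.rpow_nonneg hm0.le _)
    _ = (m : ℝ) ^ b := by rw [← Real.rpow_add hm0, sub_add_cancel]

/-- The two elementary exponent comparisons behind `n ≤ N` and `n ^ (2-δ) ≤ (m ^ (1-ε)) ^ L`:
for `0 < δ ≤ 1` and `0 ≤ ℓ`, with `θ := (δ ℓ / 8 + ℓ) / (2 + δ)`, one has `θ ≤ ℓ (1/2 - δ/8)`
(equivalently `δ (1 - δ) ℓ ≥ 0`) and `θ (2 - δ) ≤ (1 - δ/8) ℓ` (equivalently `3 δ ℓ / 2 ≥ 0`). -/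
private theorem exponent_gaps (δ : ℝ) (hδ : 0 < δ) (hδ1 : δ ≤ 1) (ℓ : ℝ) (hℓ : 0 ≤ ℓ) :
    (δ / 8 * ℓ + ℓ) / (2 + δ) ≤ ℓ * (1 / 2 - δ / 8) ∧
      (δ / 8 * ℓ + ℓ) / (2 + δ) * (2 - δ) ≤ (1 - δ / 8) * ℓ := by
  have h2δ : (0 : ℝ) < 2 + δ := by positivity
  constructor
  · rw [div_le_iff₀ h2δ]
    nlinarith [mul_nonneg hℓ (mul_nonneg hδ.le (sub_nonneg.mpr hδ1))]
  · rw [div_mul_eq_mul_div, div_le_iff₀ h2δ]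
    nlinarith [mul_nonneg hℓ hδ.le]

/-- **Stub `stub_capBookkeeping`** (exponent bookkeeping of the capacity-gadget skeleton, line
`Sketch`): for `0 < δ ≤ 1` one can fix `ε > 0` (namely `ε = δ / 8`) and then, for every `n₀`, a
threshold `m₀` such that for every `m ≥ m₀`, uniformly in the word length `L ≥ 1`, any number
`N ≥ (m ^ L) ^ (1/2 - ε)` of blocks and any host prime `p ≤ 2·3^L·m^L` leave room for a number `n`
of blocks with `n₀ ≤ n ≤ N`, `p ≤ n ^ (2 + δ)` and `n ^ (2 - δ) ≤ (m ^ (1 - ε)) ^ L`.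
Choice: `n = max n₀ ⌈(2·3^L·m^L) ^ (1/(2+δ))⌉₊`; the threshold only asks
`6 (n₀ + 2) ^ (2 + δ) ≤ m ^ (δ / 8)`. -/
theorem stub_capBookkeeping (δ : ℝ) (hδ : 0 < δ) (hδ1 : δ ≤ 1) :
    ∃ ε : ℝ, 0 < ε ∧ ∀ n₀ : ℕ, ∃ m₀ : ℕ, ∀ m : ℕ, m₀ ≤ m → ∀ L : ℕ, 1 ≤ L →
      ∀ N : ℕ, ((m : ℝ) ^ (L : ℝ)) ^ (1 / 2 - ε) ≤ (N : ℝ) →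
      ∀ p : ℕ, p ≤ 2 * (3 ^ L * m ^ L) →
        ∃ n : ℕ, n₀ ≤ n ∧ n ≤ N ∧ (p : ℝ) ≤ (n : ℝ) ^ (2 + δ) ∧
          (n : ℝ) ^ (2 - δ) ≤ ((m : ℝ) ^ (1 - ε)) ^ L := by
  refine ⟨δ / 8, by positivity, fun n₀ => ?_⟩
  have h2δ : (0 : ℝ) < 2 + δ := by positivity
  /- the constant `q = (n₀+2)^(2+δ)` and the threshold `6 q ≤ m ^ (δ/8)` -/
  have h02 : (0 : ℝ) ≤ (n₀ : ℝ) + 2 := by positivity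
  have hq1 : (1 : ℝ) ≤ ((n₀ : ℝ) + 2) ^ (2 + δ) :=
    Real.one_le_rpow (by linarith [(n₀.cast_nonneg : (0 : ℝ) ≤ n₀)]) h2δ.le
  set q : ℝ := ((n₀ : ℝ) + 2) ^ (2 + δ) with hq
  have hq0 : (0 : ℝ) < q := one_pos.trans_le hq1
  have hc0 : (0 : ℝ) < 6 * q := by positivity
  obtain ⟨m₁, hm₁⟩ := eventually_dominates (6 * q) 0 (δ / 8) hc0 (by positivity)
  refine ⟨max 1 m₁, fun m hm L hL N hN p hp => ?_⟩
  have hm1 : 1 ≤ m := le_trans (le_max_left _ _) hm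
  have hmm₁ : m₁ ≤ m := le_trans (le_max_right _ _) hm
  have hm1R : (1 : ℝ) ≤ m := by exact_mod_cast hm1
  have hm0R : (0 : ℝ) ≤ m := zero_le_one.trans hm1R
  have hmpos : (0 : ℝ) < m := zero_lt_one.trans_le hm1R
  have hcm : 6 * q ≤ (m : ℝ) ^ (δ / 8) := by
    have h := hm₁ m hmm₁
    rwa [Real.rpow_zero, mul_one] at h
  have hL0 : L ≠ 0 := by omega
  obtain ⟨hgap₁, hgap₂⟩ := exponent_gaps δ hδ hδ1 (L : ℝ) L.cast_nonneg
  /- `X = 2·3^L·m^L`, `A = X ^ (1/(2+δ))`, `n₁ = ⌈A⌉₊`, `n = max n₀ n₁ ≤ B = (n₀ + 2) A` -/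
  set X : ℝ := 2 * (3 ^ L * (m : ℝ) ^ L) with hX
  have hX1 : 1 ≤ X := by
    have h : (1 : ℝ) ≤ 3 ^ L * (m : ℝ) ^ L :=
      one_le_mul_of_one_le_of_one_le (one_le_pow₀ (by norm_num)) (one_le_pow₀ hm1R)
    rw [hX]
    linarith
  have hX0 : 0 ≤ X := zero_le_one.trans hX1
  set A : ℝ := X ^ (2 + δ)⁻¹ with hA
  have hA1 : 1 ≤ A := Real.one_le_rpow hX1 (inv_nonneg.mpr h2δ.le)
  have hA0 : 0 ≤ A := zero_le_one.trans hA1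
  set n₁ : ℕ := ⌈A⌉₊ with hn₁
  set B : ℝ := ((n₀ : ℝ) + 2) * A with hB
  have hB0 : 0 ≤ B := mul_nonneg h02 hA0
  have hnB : ((max n₀ n₁ : ℕ) : ℝ) ≤ B := by
    rw [Nat.cast_max, hB]
    refine max_le ?_ ?_
    · nlinarith [mul_nonneg (n₀.cast_nonneg : (0 : ℝ) ≤ n₀) (sub_nonneg.mpr hA1)]
    · have h1 : (n₁ : ℝ) < A + 1 := Nat.ceil_lt_add_one hA0
      nlinarith [mul_nonneg (n₀.cast_nonneg : (0 : ℝ) ≤ n₀) hA0]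
  /- the key estimate: `B ^ (2+δ) = q X ≤ m ^ (δ L / 8 + L)`, hence `B ≤ m ^ θ` -/
  have hBpow : B ^ (2 + δ) = q * X := by
    rw [hB, Real.mul_rpow h02 hA0, hA, Real.rpow_inv_rpow hX0 h2δ.ne']
  have h36 : (2 : ℝ) * 3 ^ L ≤ 6 ^ L := by
    calc (2 : ℝ) * 3 ^ L ≤ 2 ^ L * 3 ^ L :=
          mul_le_mul_of_nonneg_right (le_self_pow₀ (by norm_num) hL0) (by positivity)
      _ = 6 ^ L := by rw [← mul_pow]; norm_num
  have hqL : q ≤ q ^ L := le_self_pow₀ hq1 hL0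
  have hkey : q * X ≤ (m : ℝ) ^ (δ / 8 * L + L) := by
    calc q * X = 2 * 3 ^ L * q * (m : ℝ) ^ L := by rw [hX]; ring
      _ ≤ 6 ^ L * q ^ L * (m : ℝ) ^ L :=
          mul_le_mul_of_nonneg_right (mul_le_mul h36 hqL hq0.le (by positivity)) (by positivity)
      _ = (6 * q) ^ L * (m : ℝ) ^ L := by rw [mul_pow]
      _ ≤ ((m : ℝ) ^ (δ / 8)) ^ L * (m : ℝ) ^ L :=
          mul_le_mul_of_nonneg_right (pow_le_pow_left₀ hc0.le hcm L) (by positivity)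
      _ = (m : ℝ) ^ (δ / 8 * L + L) := by
          rw [Real.rpow_add hmpos, Real.rpow_mul_natCast hm0R, Real.rpow_natCast]
  have hBθ : B ≤ (m : ℝ) ^ ((δ / 8 * L + L) / (2 + δ)) := by
    calc B = (B ^ (2 + δ)) ^ (2 + δ)⁻¹ := (Real.rpow_rpow_inv hB0 h2δ.ne').symm
      _ ≤ ((m : ℝ) ^ (δ / 8 * L + L)) ^ (2 + δ)⁻¹ :=
          Real.rpow_le_rpow (Real.rpow_nonneg hB0 _) (hBpow.trans_le hkey)
            (inv_nonneg.mpr h2δ.le)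
      _ = (m : ℝ) ^ ((δ / 8 * L + L) / (2 + δ)) := by
          rw [← Real.rpow_mul hm0R, ← div_eq_mul_inv]
  refine ⟨max n₀ n₁, le_max_left _ _, ?_, ?_, ?_⟩
  · /- `n ≤ N` -/
    have hle : ((max n₀ n₁ : ℕ) : ℝ) ≤ (N : ℝ) := by
      calc ((max n₀ n₁ : ℕ) : ℝ) ≤ B := hnB
        _ ≤ (m : ℝ) ^ ((δ / 8 * L + L) / (2 + δ)) := hBθ
        _ ≤ (m : ℝ) ^ ((L : ℝ) * (1 / 2 - δ / 8)) :=
            Real.rpow_le_rpow_of_exponent_le hm1R hgap₁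
        _ = ((m : ℝ) ^ (L : ℝ)) ^ (1 / 2 - δ / 8) := Real.rpow_mul hm0R _ _
        _ ≤ N := hN
    exact_mod_cast hle
  · /- `p ≤ n ^ (2+δ)` -/
    have hpX : (p : ℝ) ≤ X := by
      rw [hX]
      exact_mod_cast hp
    have hAn : A ≤ ((max n₀ n₁ : ℕ) : ℝ) :=
      (Nat.le_ceil A).trans (by exact_mod_cast le_max_right n₀ n₁)
    calc (p : ℝ) ≤ X := hpX
      _ = A ^ (2 + δ) := by rw [hA, Real.rpow_inv_rpow hX0 h2δ.ne']
      _ ≤ ((max n₀ n₁ : ℕ) : ℝ) ^ (2 + δ) := Real.rpow_le_rpow hA0 hAn h2δ.le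
  · /- `n ^ (2-δ) ≤ (m ^ (1-ε)) ^ L` -/
    calc ((max n₀ n₁ : ℕ) : ℝ) ^ (2 - δ) ≤ B ^ (2 - δ) :=
          Real.rpow_le_rpow (by positivity) hnB (by linarith)
      _ ≤ ((m : ℝ) ^ ((δ / 8 * L + L) / (2 + δ))) ^ (2 - δ) :=
          Real.rpow_le_rpow hB0 hBθ (by linarith)
      _ = (m : ℝ) ^ ((δ / 8 * L + L) / (2 + δ) * (2 - δ)) := (Real.rpow_mul hm0R _ _).symm
      _ ≤ (m : ℝ) ^ ((1 - δ / 8) * L) := Real.rpow_le_rpow_of_exponent_le hm1R hgap₂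
      _ = ((m : ℝ) ^ (1 - δ / 8)) ^ L := Real.rpow_mul_natCast hm0R _ _

end Summit.MatrixMultiplication.MatrixMultiplication.Theorems.PrimeTwoFamilies.CapacityLift
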